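import Summits.HodgeConjecture.HodgeConjecture.Theorems.PadicSemiregularLiftFermatAnchorAssemblyEulerBaseChangeRank

/-!
# The Lefschetz principle for `homDim`, `eulerForm`, `thetaPoly`, `IsRigid` (line `witt-lift-rigid-mf`)

Crux `FermatAnchorAssembly` (stmt-HodgeConjecture-14874), route `PadicSemiregularLift` of `HodgeConjecture`,
line `witt-lift-rigid-mf`, stub `stub_readoutCore` (the characteristic-zero readout). Step (0) of its printed
proof is the LEFSCHETZ PRINCIPLE: every invariant of the homotopy category of `L`-graded matrix factorizations
that the vocabulary (`Theorems/PadicSemiregularLiftFermatAnchorAssemblyGMFDefs.lean`) defines as a `finrank`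
over the coefficient field `K` is unchanged under ANY extension of scalars `σ : K →+* K'` of fields, so the
readout may be run over any larger field (e.g. `ℂ`). This file proves it on the constructive carriers, for
LAWFUL pairs (where `null ⊆ closed` and `homDim = dim C_t − dRank_t − hRank_t`, `…EulerHomDim`):

* `linearIndependent_pairMap_of_field`, `finrank_span_pairMap_of_field` — extension of scalars along a
  field map preserves linear independence, hence the rank, of a finite family of pairs of polynomial
  matrices (coefficientwise: expand a `K'`-relation in a `K`-basis of the span of its coefficients);
* `GMFData.dRank_map_of_field`, `GMFData.hRank_map_of_field` — the ranks of the two differentials of the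
  Hom complex are unchanged (`dRank_baseChange`, `hRank_baseChange` of `…EulerBaseChangeRank` express them
  as ranks of the `σ`-image of ONE family of vectors over `K`);
* `GMFData.homDim_map_of_field` : `homDim K' L t (M ⊗_σ K') (N ⊗_σ K') = homDim K L t M N`;
* `GMFData.isRigid_map_iff`, `GMFData.eulerForm_map_of_field`, `GMFData.thetaPoly_map_of_field`
  (`Θ_{γ, N ⊗_σ K'}` computed with `σ ζ` is `Θ_{γ,N}` computed with `ζ`, for `ζᵐ = 1`; uses `twist_map`,
  `shift_map` of `…GMFBaseChange`).

All `[folklore]` (finite linear algebra); no named fact, no `sorry`.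
-/

-- `Summit.HodgeConjecture.HodgeConjecture.…` is the tree's mandated summit/problem namespace (single-problem summit).
set_option linter.dupNamespace false

noncomputable section

open Finset Module

namespace Summit.HodgeConjecture.HodgeConjecture.Cruxes.FermatAnchorAssembly.WittLiftRigidMf

variable {ν m : ℕ}

/-! ### Coefficients of pairs of polynomial matrices -/

section Coeff

variable {A B : Type} [CommRing A] [CommRing B] {α β γ δ : Type}

/-- A pair of polynomial matrices all of whose coefficients vanish is zero. [folklore] -/
theorem eq_zero_of_coeff_entryAt_eq_zero
    {z : Matrix α β (MvPolynomial (Fin ν) A) × Matrix γ δ (MvPolynomial (Fin ν) A)}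
    (h : ∀ pos e, (entryAt pos z).coeff e = 0) : z = 0 :=
  ext_entryAt fun pos ↦ by
    rw [entryAt_zero]
    exact MvPolynomial.ext _ _ fun e ↦ by rw [MvPolynomial.coeff_zero]; exact h pos e

/-- Coefficients commute with change of coefficients: `coeff (σ_* z) = σ (coeff z)`. [folklore] -/
theorem coeff_entryAt_pairMap (σ : A →+* B) (pos : (α × β) ⊕ (γ × δ)) (e : Fin ν →₀ ℕ)
    (z : Matrix α β (MvPolynomial (Fin ν) A) × Matrix γ δ (MvPolynomial (Fin ν) A)) :
    (entryAt pos (pairMap σ z)).coeff e = σ ((entryAt pos z).coeff e) := by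
  rw [entryAt_pairMap, MvPolynomial.coeff_map]

/-- Each coefficient of a pair of polynomial matrices is a linear functional: coefficients of a linear
combination. [folklore] -/
theorem coeff_entryAt_sum_smul {J : Type} (s : Finset J) (c : J → A)
    (y : J → Matrix α β (MvPolynomial (Fin ν) A) × Matrix γ δ (MvPolynomial (Fin ν) A))
    (pos : (α × β) ⊕ (γ × δ)) (e : Fin ν →₀ ℕ) :
    (entryAt pos (∑ j ∈ s, c j • y j)).coeff e = ∑ j ∈ s, c j * (entryAt pos (y j)).coeff e := by
  -- the `(pos, e)`-coefficient as an `A`-linear functional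
  let Φ : (Matrix α β (MvPolynomial (Fin ν) A) × Matrix γ δ (MvPolynomial (Fin ν) A)) →ₗ[A] A :=
    { toFun := fun z ↦ (entryAt pos z).coeff e
      map_add' := fun z z' ↦ by rw [entryAt_add, MvPolynomial.coeff_add]
      map_smul' := fun a z ↦ by rw [entryAt_smul, MvPolynomial.coeff_smul, RingHom.id_apply] }
  change Φ (∑ j ∈ s, c j • y j) = ∑ j ∈ s, c j * Φ (y j)
  rw [map_sum]
  simp only [map_smul, smul_eq_mul]

end Coeff

/-! ### Extension of scalars along a field map preserves linear independence and ranks -/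

section FieldExtension

variable {K K' : Type} [Field K] [Field K'] (σ : K →+* K') {α β γ δ : Type}

/-- `σ_*` maps `K`-spans into `K'`-spans. [folklore] -/
theorem pairMap_mem_span {S : Set (Matrix α β (MvPolynomial (Fin ν) K) × Matrix γ δ (MvPolynomial (Fin ν) K))}
    {z : Matrix α β (MvPolynomial (Fin ν) K) × Matrix γ δ (MvPolynomial (Fin ν) K)}
    (hz : z ∈ Submodule.span K S) : pairMap σ z ∈ Submodule.span K' (pairMap σ '' S) := by
  induction hz using Submodule.span_induction with
  | mem x hx => exact Submodule.subset_span ⟨x, hx, rfl⟩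
  | zero => rw [map_zero]; exact zero_mem _
  | add x y _ _ hx hy => rw [map_add]; exact add_mem hx hy
  | smul a x _ hx => rw [pairMap_smul]; exact Submodule.smul_mem _ _ hx

/-- **Extension of scalars along a field map preserves linear independence** of a finite family of pairs
of polynomial matrices: if `y` is `K`-linearly independent then `σ_* ∘ y` is `K'`-linearly independent.
Proof: expand the coefficients `c_j ∈ K'` of a relation in a `K`-basis `(w_l)` of their `K`-span inside
`K'`, `c_j = Σ_l σ(a_{jl}) w_l`; each coefficient of the relation reads `Σ_l σ(Σ_j a_{jl}·coeff(y_j)) w_l = 0`,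
so `Σ_j a_{jl} y_j = 0` coefficientwise, so `a = 0`. [folklore] -/
theorem linearIndependent_pairMap_of_field {J : Type} [Fintype J]
    {y : J → Matrix α β (MvPolynomial (Fin ν) K) × Matrix γ δ (MvPolynomial (Fin ν) K)}
    (hy : LinearIndependent K y) : LinearIndependent K' (fun j ↦ pairMap σ (y j)) := by
  classical
  letI : Algebra K K' := σ.toAlgebra
  have hσ : ∀ x, σ x = algebraMap K K' x := fun _ ↦ rfl
  rw [Fintype.linearIndependent_iff] at hy ⊢
  intro c hc
  -- the `K`-span of the coefficients inside `K'` and a basis of it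
  let W : Submodule K K' := Submodule.span K (Set.range c)
  haveI : Module.Finite K W := Module.Finite.span_of_finite K (Set.finite_range c)
  let b := Module.finBasis K W
  have hcW : ∀ j, c j ∈ W := fun j ↦ Submodule.subset_span ⟨j, rfl⟩
  have hbli : LinearIndependent K (fun l ↦ (b l : K')) := b.linearIndependent.map' W.subtype W.ker_subtype
  obtain ⟨a, ha⟩ : ∃ a : J → Fin (Module.finrank K W) → K,
      ∀ j, c j = ∑ l, algebraMap K K' (a j l) * (b l : K') := by
    refine ⟨fun j l ↦ b.repr ⟨c j, hcW j⟩ l, fun j ↦ ?_⟩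
    have h1 := congrArg Subtype.val (b.sum_repr ⟨c j, hcW j⟩)
    simp only [Submodule.coe_sum, Submodule.coe_smul, Algebra.smul_def] at h1
    exact h1.symm
  -- every `K`-combination `Σ_j a_{jl} y_j` vanishes (coefficientwise)
  have hrel : ∀ l, ∑ j, a j l • y j = 0 := by
    intro l
    apply eq_zero_of_coeff_entryAt_eq_zero
    intro pos e
    have h0 : ∑ j, c j * σ ((entryAt pos (y j)).coeff e) = 0 := by
      have := congrArg (fun z ↦ (entryAt pos z).coeff e) hc
      simpa only [coeff_entryAt_sum_smul, coeff_entryAt_pairMap, entryAt_zero,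
        MvPolynomial.coeff_zero] using this
    have h1 : ∑ l', (∑ j, a j l' * (entryAt pos (y j)).coeff e) • (b l' : K') = 0 := by
      rw [← h0]
      simp_rw [ha, Finset.sum_mul, Algebra.smul_def, map_sum, Finset.sum_mul, hσ, map_mul]
      rw [Finset.sum_comm]
      refine Finset.sum_congr rfl fun j _ ↦ Finset.sum_congr rfl fun l' _ ↦ ?_
      ring
    have h2 := Fintype.linearIndependent_iff.mp hbli _ h1 l
    rw [coeff_entryAt_sum_smul]
    exact h2
  -- hence `a = 0` and `c = 0`
  intro j
  rw [ha j]
  refine Finset.sum_eq_zero fun l _ ↦ ?_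
  rw [hy (fun j ↦ a j l) (hrel l) j, map_zero, zero_mul]

/-- **Extension of scalars along a field map preserves the rank of a finite family of pairs of polynomial
matrices**: `dim_{K'} span_{K'} (σ_* ∘ y) = dim_K span_K y`. [folklore] -/
theorem finrank_span_pairMap_of_field {J : Type} [Finite J]
    (y : J → Matrix α β (MvPolynomial (Fin ν) K) × Matrix γ δ (MvPolynomial (Fin ν) K)) :
    finrank K' (Submodule.span K' (Set.range (fun j ↦ pairMap σ (y j)))) =
      finrank K (Submodule.span K (Set.range y)) := by
  classical
  haveI : Fintype J := Fintype.ofFinite J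
  obtain ⟨κ, a, ha, hspan, hli⟩ := exists_linearIndependent' (K := K) y
  haveI : Fintype κ := Fintype.ofInjective a ha
  have hli' : LinearIndependent K' (fun k ↦ pairMap σ (y (a k))) :=
    linearIndependent_pairMap_of_field σ (y := fun k ↦ y (a k)) hli
  have hs : Submodule.span K' (Set.range (fun j ↦ pairMap σ (y j))) =
      Submodule.span K' (Set.range (fun k ↦ pairMap σ (y (a k)))) := by
    apply le_antisymm
    · rw [Submodule.span_le]
      rintro _ ⟨j, rfl⟩
      have hj : y j ∈ Submodule.span K (Set.range (y ∘ a)) := by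
        rw [hspan]; exact Submodule.subset_span ⟨j, rfl⟩
      have := pairMap_mem_span σ hj
      rwa [← Set.range_comp] at this
    · apply Submodule.span_mono
      rintro _ ⟨k, rfl⟩
      exact ⟨a k, rfl⟩
  rw [hs, finrank_span_eq_card hli', ← hspan, finrank_span_eq_card hli]

end FieldExtension

/-! ### Ranks of the differentials, `homDim`, `eulerForm`, `thetaPoly`, `IsRigid` under extension of scalars -/

namespace GMFData

variable {K K' : Type} [Field K] [Field K'] (σ : K →+* K') {ι₀ ι₁ κ₀ κ₁ : Type}
  [Fintype ι₀] [Fintype ι₁] [Fintype κ₀] [Fintype κ₁]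

/-- `dRank` as the rank of the images of the monomial basis of the even cochains. [folklore] -/
theorem dRank_eq_finrank_span (L : AddSubgroup (Fin ν → ZMod m)) (t : ℤ) (M : GMFData K ν m ι₀ ι₁)
    (N : GMFData K ν m κ₀ κ₁) :
    dRank L t M N = finrank K (Submodule.span K
      (Set.range (fun q ↦ dMap M N (homogBasis K L (evenLabel t M N) q)))) := by
  classical
  unfold dRank
  rw [cochainSub_eq_homogSub, homogSub_eq_span_homogBasis, Submodule.map_span, ← Set.range_comp]
  rfl

/-- `hRank` as the rank of the images of the monomial basis of the odd cochains. [folklore] -/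
theorem hRank_eq_finrank_span (L : AddSubgroup (Fin ν → ZMod m)) (t : ℤ) (M : GMFData K ν m ι₀ ι₁)
    (N : GMFData K ν m κ₀ κ₁) :
    hRank L t M N = finrank K (Submodule.span K
      (Set.range (fun q ↦ hMap M N (homogBasis K L (oddLabel t M N) q)))) := by
  classical
  unfold hRank nullSub
  rw [oddSub_eq_homogSub, homogSub_eq_span_homogBasis, Submodule.map_span, ← Set.range_comp]
  rfl

/-- **The rank of the even differential is unchanged under extension of scalars along a field map.** [folklore] -/
theorem dRank_map_of_field (L : AddSubgroup (Fin ν → ZMod m)) (t : ℤ) (M : GMFData K ν m ι₀ ι₁)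
    (N : GMFData K ν m κ₀ κ₁) : dRank L t (M.map σ) (N.map σ) = dRank L t M N := by
  classical
  rw [dRank_baseChange, dRank_eq_finrank_span]
  exact finrank_span_pairMap_of_field σ _

/-- **The rank of the odd differential is unchanged under extension of scalars along a field map.** [folklore] -/
theorem hRank_map_of_field (L : AddSubgroup (Fin ν → ZMod m)) (t : ℤ) (M : GMFData K ν m ι₀ ι₁)
    (N : GMFData K ν m κ₀ κ₁) : hRank L t (M.map σ) (N.map σ) = hRank L t M N := by
  classical
  rw [hRank_baseChange, hRank_eq_finrank_span]
  exact finrank_span_pairMap_of_field σ _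

variable [DecidableEq ι₀] [DecidableEq ι₁] [DecidableEq κ₀] [DecidableEq κ₁]
  {L : AddSubgroup (Fin ν → ZMod m)}

/-- **Lefschetz principle for `homDim`**: for a lawful pair `(M, N)` over a field `K` and any field map
`σ : K →+* K'`, `dim_{K'} Hom(M ⊗_σ K', (N ⊗_σ K')(t)) = dim_K Hom(M, N(t))` — `homDim` is
`dim C_t − dRank_t − hRank_t`, the cochain dimension depends only on the labels and the two ranks are
extension-invariant. [folklore] -/
theorem homDim_map_of_field (M : GMF K ν m L ι₀ ι₁) (N : GMF K ν m L κ₀ κ₁) (t : ℤ) :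
    homDim K' L t (M.toGMFData.map σ) (N.toGMFData.map σ) = homDim K L t M.toGMFData N.toGMFData := by
  have h1 := homDim_add_ranks (M.baseChange σ) (N.baseChange σ) t
  have h2 := homDim_add_ranks M N t
  rw [GMF.baseChange_toGMFData, GMF.baseChange_toGMFData, dRank_map_of_field, hRank_map_of_field,
    finrank_cochainSub, evenLabel_map] at h1
  rw [finrank_cochainSub] at h2
  omega

/-- **Rigidity is unchanged under extension of scalars along a field map.** [folklore] -/
theorem isRigid_map_iff (M : GMF K ν m L ι₀ ι₁) :
    IsRigid K' L (M.toGMFData.map σ) ↔ IsRigid K L M.toGMFData := by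
  unfold IsRigid
  rw [homDim_map_of_field]

/-- **Lefschetz principle for the Euler form**: `χ_{K'}(M ⊗_σ K', N ⊗_σ K') = χ_K(M, N)` for a lawful pair. [folklore] -/
theorem eulerForm_map_of_field (M : GMF K ν m L ι₀ ι₁) (N : GMF K ν m L κ₀ κ₁) :
    eulerForm K' L (M.toGMFData.map σ) (N.toGMFData.map σ) = eulerForm K L M.toGMFData N.toGMFData := by
  unfold eulerForm
  refine finsum_congr fun j ↦ ?_
  rw [homDim_map_of_field, shift_map, ← GMF.shift_toGMFData, homDim_map_of_field]

/-- **Lefschetz principle for the charge polynomial**: for a lawful `N` over `K`, `ζᵐ = 1` and a field map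
`σ : K →+* K'`, the charge polynomial of `N ⊗_σ K'` computed with the root of unity `σ ζ` is the charge
polynomial of `N` computed with `ζ` (`σ_*(g^*N) = g^*(σ_* N)`, `twist_map`). [folklore] -/
theorem thetaPoly_map_of_field [NeZero m] {ζ : K} (hζ : ζ ^ m = 1) (γ : Fin ν → ZMod m)
    (N : GMF K ν m L κ₀ κ₁) :
    thetaPoly K' L (σ ζ) γ (N.toGMFData.map σ) = thetaPoly K L ζ γ N.toGMFData := by
  unfold thetaPoly
  refine Finset.sum_congr rfl fun g _ ↦ ?_
  rw [twist_map, ← GMF.twist_toGMFData ζ hζ g N, eulerForm_map_of_field]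

end GMFData

/-! ### Registered sub-goals (∀-form): step (0) of the readout — `homDim` and the charge data are Lefschetz invariants -/

/-- **Registered sub-goal: the Lefschetz principle for `homDim`.** For fields `K`, `K'`, any field map
`σ : K →+* K'` and a lawful pair `(M, N)` of `L`-graded matrix factorizations of `Σ_{i<ν} xᵢᵐ` over `K`,
`dim_{K'} Hom(M ⊗_σ K', (N ⊗_σ K')(t)) = dim_K Hom(M, N(t))` for every twist `t`. [folklore] -/
theorem homDim_baseChange_of_field : ∀ (K K' : Type) [Field K] [Field K'] (σ : K →+* K') (ν m : ℕ)
    (L : AddSubgroup (Fin ν → ZMod m)) (ι₀ ι₁ κ₀ κ₁ : Type) [Fintype ι₀] [Fintype ι₁] [Fintype κ₀]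
    [Fintype κ₁] [DecidableEq ι₀] [DecidableEq ι₁] [DecidableEq κ₀] [DecidableEq κ₁]
    (M : GMF K ν m L ι₀ ι₁) (N : GMF K ν m L κ₀ κ₁) (t : ℤ),
    GMFData.homDim K' L t (M.toGMFData.map σ) (N.toGMFData.map σ) =
      GMFData.homDim K L t M.toGMFData N.toGMFData :=
  fun _ _ _ _ σ _ _ _ _ _ _ _ _ _ _ _ _ _ _ _ M N t ↦ GMFData.homDim_map_of_field σ M N t


/-- **Registered sub-goal: step (0) of `stub_readoutCore` (Lefschetz principle), on the constructive carriers.**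
For fields `K`, `K'`, a field map `σ : K →+* K'`, `ζ ∈ K` with `ζᵐ = 1` and a lawful `L`-graded matrix
factorization `N` of `Σ_{i<ν} xᵢᵐ` over `K`: the base change `N ⊗_σ K'` is lawful, is rigid iff `N` is, and
has the same charge polynomial (at `σ ζ`) as `N` (at `ζ`). So the characteristic-zero readout may be run
over any field extension (e.g. over `ℂ` after descending `N` to a finitely generated subfield). [folklore] -/
theorem readout_baseChange_invariants : ∀ (K K' : Type) [Field K] [Field K'] (σ : K →+* K') (ν m : ℕ)
    [NeZero m] (L : AddSubgroup (Fin ν → ZMod m)) (ι₀ ι₁ : Type) [Fintype ι₀] [Fintype ι₁] [DecidableEq ι₀]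
    [DecidableEq ι₁] (ζ : K), ζ ^ m = 1 → ∀ (γ : Fin ν → ZMod m) (N : GMF K ν m L ι₀ ι₁),
    ∃ N' : GMF K' ν m L ι₀ ι₁, N'.toGMFData = N.toGMFData.map σ ∧
      (GMFData.IsRigid K' L N'.toGMFData ↔ GMFData.IsRigid K L N.toGMFData) ∧
      GMFData.thetaPoly K' L (σ ζ) γ N'.toGMFData = GMFData.thetaPoly K L ζ γ N.toGMFData :=
  fun _ _ _ _ σ _ _ _ _ _ _ _ _ _ _ _ hζ γ N ↦ ⟨N.baseChange σ, rfl, GMFData.isRigid_map_iff σ N,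
    GMFData.thetaPoly_map_of_field σ hζ γ N⟩

end Summit.HodgeConjecture.HodgeConjecture.Cruxes.FermatAnchorAssembly.WittLiftRigidMf

end
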